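import Summits.AnomalousDissipation.AnomalousDissipation.Theorems.SawtoothPulseCascadeK2InjectionCap5
import Summits.AnomalousDissipation.AnomalousDissipation.Theorems.SawtoothPulseCascadeK3LocalisedClosurePointGlueP

/-!
# The rung `Target` from ONE one-phase transfer inequality (cap `5`) at the design point `⟨8, δ₀, 2, 1, 2⟩`
(route `AnomalousDissipation/SawtoothPulseCascade`; helper for the K2″ crux stmt-AnomalousDissipation-19696
`K2LinearisedCascadeGrowth` — registered line `phase-cocycle`, stub B `stub_phaseCocycle` — and its consumer `Target` =
stmt-AnomalousDissipation-20024; `--supports`)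

The registered line `phase-cocycle` of K2″ (skeleton 0c87d78a; δ₀ = 1/4, cap `3`, box `γ ∈ [4,8]`, `ρN ∈ {2,…,7}`) cuts
the crux into the INJECTION PHASE (stub A) and the ONE-PHASE TRANSFER for comb-generated states (stub B, load-bearing),
composed by induction over the phases (`envelope_of_stubs`, box-level).  Meanwhile the tree closes the rung `Target` from
K2 ALONE at the K1loc′ point `⟨8, δ₀, 2, 1, 2⟩`, `0 < δ₀ ≤ 2⁻¹⁰⁰`, with cap `5` (`target_of_K2cap_le_five`,
`target_of_K2H_five`; K1loc′ = `K1Window.k1Localised_ctg`, p663045), and at cap `5` the injection phase is a THEOREM for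
every `γ ≤ 8` and every `ν > 0` (`K2Classical.k2_injectionPhase_cap5`).  This file does the POINTWISE composition, with a
guard `G` on the phase index so that the plain and the horizon forms are one induction:

* `envelope_of_phaseTransfer` — pointwise in `P` (`0 ≤ γ ≤ 8`, `δ₀ > 0`, `d > 0`) and `ν > 0`, for any guard `G` closed
  downwards: the one-phase transfer inequality with cap `5` (target phases `J + 1` with `G (J + 1)`) gives the envelope
  `‖w(t)‖² ≤ ((5e^{σ⋆γ})²)^{n+1} ‖w₀‖²` on `[tInject j₀ hz, tStart (j₀+n+1)]` whenever `G (j₀ + n)`;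
* `k2PhaseGrowthClassical_five_of_phaseTransfer` — the plain form (`G = ⊤`) gives `K2PhaseGrowthClassical P 5`;
* `k2PhaseGrowthClassicalH_five_of_phaseTransferH` — the horizon form (`G J = (J < J_{γ²−3}(ν) + A)`, threshold `ν₀`
  per lag `A`) gives `K2PhaseGrowthClassicalH P 5`;
* `target_of_phaseTransfer_eight`, `target_of_phaseTransferH_eight` — **`Target` from the (horizon) one-phase transfer
  inequality at `⟨8, δ₀, 2, 1, 2⟩`, `0 < δ₀ ≤ 2⁻¹⁰⁰`, cap `5`**: per-phase `L²` factor `5e^{8σ⋆} ≈ 59.6` for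
  comb-generated classical linearised responses, against the energy method's `e^{8} ≈ 2981`.

No definition is introduced (the transfer inequality is written out as a hypothesis); nothing here bounds a transfer —
the hypothesis is exactly the Kelvin–Helmholtz / Orr content of K2″ (stub B of `phase-cocycle`, specialised to the design
point and relaxed to cap `5`).
-/

-- `Summit.<Summit>.<Problem>` is the tree's mandated summit-side namespace (CONVENTIONS §2); for this
-- single-conjunct summit the two coincide, so the duplicate is deliberate (lakefile: off for `Summits`).
set_option linter.dupNamespace false

noncomputable section

namespace Summit.AnomalousDissipation.AnomalousDissipation.Theorems.SawtoothPulseCascade.K2Classical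

open Set MeasureTheory
open Literature.Analysis Literature.Analysis.FunctionSpaces Literature.Analysis.FluidPDE
open Literature.Analysis.FluidPDE.SawtoothCascade
open Literature.Analysis.FluidPDE.SawtoothCascade.CascadeParams
open Summit.AnomalousDissipation.AnomalousDissipation.Theses.SawtoothPulseCascade

/-! ## Bookkeeping -/

/-- The one-sided time derivative within a non-degenerate sub-interval `[a', b'] ⊆ [a, b]` of a field jointly smooth on
`[a, b]` agrees with the one within `[a, b]` (Mathlib `HasDerivWithinAt.mono`, `HasDerivWithinAt.derivWithin`). -/
private theorem timeDerivWithin_Icc_eq_of_subset_pc {a b a' b' : ℝ} (hlt : a' < b')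
    (hsub : Icc a' b' ⊆ Icc a b) {w : ℝ → UnitAddTorus (Fin 2) → EuclideanSpace ℝ (Fin 2)}
    (hw : Torus.IsSmoothSpaceTimeOn (Icc a b) w) {t : ℝ} (ht : t ∈ Icc a' b')
    (x : UnitAddTorus (Fin 2)) :
    Torus.timeDerivWithin (Icc a' b') w t x = Torus.timeDerivWithin (Icc a b) w t x :=
  ((hw.hasDerivWithinAt_slice (hsub ht) x).mono hsub).derivWithin (uniqueDiffOn_Icc hlt t ht)

/-- `0 ≤ ‖v‖²_{L²}`. -/
private theorem vectorL2Sq_nonneg_pc (v : UnitAddTorus (Fin 2) → EuclideanSpace ℝ (Fin 2)) :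
    0 ≤ Torus.vectorL2Sq v := by
  unfold Torus.vectorL2Sq
  exact integral_nonneg fun _ => by positivity

/-- `1 ≤ (5e^{σ⋆γ})²` for `γ ≥ 0`. -/
private theorem one_le_cap5_sq {γ : ℝ} (hγ : 0 ≤ γ) : 1 ≤ (5 * Real.exp (sawSigmaStar * γ)) ^ 2 := by
  have h0 : (0 : ℝ) ≤ sawSigmaStar * γ := mul_nonneg (by norm_num [sawSigmaStar]) hγ
  have h1 : 1 ≤ 5 * Real.exp (sawSigmaStar * γ) := by linarith [Real.one_le_exp h0]
  exact one_le_pow₀ h1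

/-! ## §1 The envelope from the one-phase transfer inequality, pointwise, under a guard -/

/-- **Envelope by induction over the phases, pointwise** (`0 ≤ γ ≤ 8`, `δ₀ > 0`, `d > 0`, one `ν > 0`).  Let `G` be a
guard on phase indices closed downwards (`G (J+1) → G J`).  Assume the ONE-PHASE TRANSFER inequality with cap `5` at
`P`: every classical linearised response `(w, q)` along the cascade carrier on `[tInject j₀ hz, tStart (J+2)]` from a
residual-comb injection `w₀` at phase `j₀ ≤ J`, with target phase admitted by the guard (`G (J + 1)`), whose energy is
`≤ B` on `[tInject j₀ hz, tStart (J+1)]`, has energy `≤ (5e^{σ⋆γ})² B` on phase `J + 1`.  Then for every `n`, `j₀`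
with `G (j₀ + n)`, every such response on `[tInject j₀ hz, tStart (j₀+n+1)]` obeys
`‖w(t)‖² ≤ ((5e^{σ⋆γ})²)^{n+1} ‖w₀‖²` on the whole window (phase `j₀`: `k2_injectionPhase_cap5`, every `ν > 0`). -/
theorem envelope_of_phaseTransfer (P : CascadeParams) (hγ : 0 ≤ P.γ) (hγ8 : P.γ ≤ 8) (hδ₀ : 0 < P.δ₀)
    (hd : 0 < P.d) {ν : ℝ} (hν : 0 < ν) {G : ℕ → Prop} (hG : ∀ J, G (J + 1) → G J)
    (hT : ∀ (j₀ J : ℕ), j₀ ≤ J → G (J + 1) → ∀ (hz : Bool) (w₀ : UnitAddTorus (Fin 2) → EuclideanSpace ℝ (Fin 2))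
      (w : ℝ → UnitAddTorus (Fin 2) → EuclideanSpace ℝ (Fin 2)) (q : ℝ → UnitAddTorus (Fin 2) → ℝ),
      ShearCombDatum (P.N j₀) hz w₀ →
      Torus.IsSmoothSpaceTimeOn (Icc (CascadeParams.tInject j₀ hz) (tStart (J + 2))) w →
      Torus.IsSmoothSpaceTimeOn (Icc (CascadeParams.tInject j₀ hz) (tStart (J + 2))) q →
      (∀ t ∈ Icc (CascadeParams.tInject j₀ hz) (tStart (J + 2)), Torus.IsDivFree (w t)) →
      (∀ t ∈ Icc (CascadeParams.tInject j₀ hz) (tStart (J + 2)), ∀ x,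
        Torus.timeDerivWithin (Icc (CascadeParams.tInject j₀ hz) (tStart (J + 2))) w t x +
          Torus.convect (P.field t) (w t) x + Torus.convect (w t) (P.field t) x =
          ν • Torus.laplacian (w t) x - Torus.gradient (q t) x) →
      w (CascadeParams.tInject j₀ hz) = w₀ →
      ∀ B : ℝ, (∀ t ∈ Icc (CascadeParams.tInject j₀ hz) (tStart (J + 1)), Torus.vectorL2Sq (w t) ≤ B) →
      ∀ t ∈ Icc (tStart (J + 1)) (tStart (J + 2)),
        Torus.vectorL2Sq (w t) ≤ (5 * Real.exp (sawSigmaStar * P.γ)) ^ 2 * B) :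
    ∀ (n j₀ : ℕ), G (j₀ + n) → ∀ (hz : Bool) (w₀ : UnitAddTorus (Fin 2) → EuclideanSpace ℝ (Fin 2))
      (w : ℝ → UnitAddTorus (Fin 2) → EuclideanSpace ℝ (Fin 2)) (q : ℝ → UnitAddTorus (Fin 2) → ℝ),
      ShearCombDatum (P.N j₀) hz w₀ →
      Torus.IsSmoothSpaceTimeOn (Icc (CascadeParams.tInject j₀ hz) (tStart (j₀ + n + 1))) w →
      Torus.IsSmoothSpaceTimeOn (Icc (CascadeParams.tInject j₀ hz) (tStart (j₀ + n + 1))) q →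
      (∀ t ∈ Icc (CascadeParams.tInject j₀ hz) (tStart (j₀ + n + 1)), Torus.IsDivFree (w t)) →
      (∀ t ∈ Icc (CascadeParams.tInject j₀ hz) (tStart (j₀ + n + 1)), ∀ x,
        Torus.timeDerivWithin (Icc (CascadeParams.tInject j₀ hz) (tStart (j₀ + n + 1))) w t x +
          Torus.convect (P.field t) (w t) x + Torus.convect (w t) (P.field t) x =
          ν • Torus.laplacian (w t) x - Torus.gradient (q t) x) →
      w (CascadeParams.tInject j₀ hz) = w₀ →
      ∀ t ∈ Icc (CascadeParams.tInject j₀ hz) (tStart (j₀ + n + 1)),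
        Torus.vectorL2Sq (w t) ≤ ((5 * Real.exp (sawSigmaStar * P.γ)) ^ 2) ^ (n + 1) * Torus.vectorL2Sq w₀ := by
  have hK1 : 1 ≤ (5 * Real.exp (sawSigmaStar * P.γ)) ^ 2 := one_le_cap5_sq hγ
  intro n
  induction n with
  | zero =>
    intro j₀ _ hz w₀ w q hd0 hw hq hdiv heq h0 t ht
    simp only [Nat.add_zero] at hw hq hdiv heq ht
    have ht' : t ∈ Icc (max (CascadeParams.tInject j₀ hz) (tStart j₀)) (tStart (j₀ + 1)) :=
      ⟨max_le ht.1 ((tInject_mem_Icc j₀ hz).1.trans ht.1), ht.2⟩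
    have h := k2_injectionPhase_cap5 P hγ hγ8 hδ₀ hd hν j₀ hz w₀ w q hd0 hw hq hdiv heq h0 t ht'
    have e : 2 * (j₀ + 1 - j₀) = 2 := by rw [Nat.add_sub_cancel_left]
    rw [e] at h
    simpa only [zero_add, pow_one] using h
  | succ n ih =>
    intro j₀ hGn hz w₀ w q hd0 hw hq hdiv heq h0 t ht
    have e : j₀ + (n + 1) + 1 = j₀ + n + 2 := by omega
    rw [e] at hw hq hdiv heq ht
    have hGn' : G (j₀ + n) := hG _ (by simpa [Nat.add_assoc] using hGn)
    have hsub : Icc (CascadeParams.tInject j₀ hz) (tStart (j₀ + n + 1)) ⊆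
        Icc (CascadeParams.tInject j₀ hz) (tStart (j₀ + n + 2)) :=
      Icc_subset_Icc le_rfl (tStart_strictMono.monotone (by omega))
    have hlt : CascadeParams.tInject j₀ hz < tStart (j₀ + n + 1) :=
      lt_of_lt_of_le (tInject_lt_tStart_succ j₀ hz) (tStart_strictMono.monotone (by omega))
    have ih' : ∀ s ∈ Icc (CascadeParams.tInject j₀ hz) (tStart (j₀ + n + 1)),
        Torus.vectorL2Sq (w s) ≤ ((5 * Real.exp (sawSigmaStar * P.γ)) ^ 2) ^ (n + 1) * Torus.vectorL2Sq w₀ :=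
      ih j₀ hGn' hz w₀ w q hd0 (hw.mono hsub) (hq.mono hsub) (fun s hs => hdiv s (hsub hs))
        (fun s hs x => by
          rw [timeDerivWithin_Icc_eq_of_subset_pc hlt hsub hw hs x]
          exact heq s (hsub hs) x) h0
    have hstep := hT j₀ (j₀ + n) (Nat.le_add_right _ _) (by simpa [Nat.add_assoc] using hGn) hz w₀ w q hd0 hw hq
      hdiv heq h0 (((5 * Real.exp (sawSigmaStar * P.γ)) ^ 2) ^ (n + 1) * Torus.vectorL2Sq w₀) ih'
    have hE0 := vectorL2Sq_nonneg_pc w₀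
    rcases le_total t (tStart (j₀ + n + 1)) with h | h
    · calc Torus.vectorL2Sq (w t)
          ≤ ((5 * Real.exp (sawSigmaStar * P.γ)) ^ 2) ^ (n + 1) * Torus.vectorL2Sq w₀ := ih' t ⟨ht.1, h⟩
        _ ≤ ((5 * Real.exp (sawSigmaStar * P.γ)) ^ 2) ^ (n + 1 + 1) * Torus.vectorL2Sq w₀ :=
          mul_le_mul_of_nonneg_right (pow_le_pow_right₀ hK1 (by omega)) hE0
    · calc Torus.vectorL2Sq (w t)
          ≤ (5 * Real.exp (sawSigmaStar * P.γ)) ^ 2 *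
              (((5 * Real.exp (sawSigmaStar * P.γ)) ^ 2) ^ (n + 1) * Torus.vectorL2Sq w₀) := hstep t ⟨h, ht.2⟩
        _ = ((5 * Real.exp (sawSigmaStar * P.γ)) ^ 2) ^ (n + 1 + 1) * Torus.vectorL2Sq w₀ := by ring

/-! ## §2 The two receptacles from the transfer inequality -/

/-- **`K2PhaseGrowthClassical P 5` from the plain one-phase transfer inequality** (pointwise in `P`, `0 ≤ γ ≤ 8`,
`δ₀ > 0`, `d > 0`; threshold `ν₀` of the hypothesis): `envelope_of_phaseTransfer` with the trivial guard, and
`J = j₀ + n`, `((C²))^{n+1} = C^{2(J+1−j₀)}`. -/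
theorem k2PhaseGrowthClassical_five_of_phaseTransfer (P : CascadeParams) (hγ : 0 ≤ P.γ) (hγ8 : P.γ ≤ 8)
    (hδ₀ : 0 < P.δ₀) (hd : 0 < P.d)
    (hT : ∃ ν₀ : ℝ, 0 < ν₀ ∧ ∀ ν ∈ Ioc 0 ν₀, ∀ (j₀ J : ℕ), j₀ ≤ J → ∀ (hz : Bool)
      (w₀ : UnitAddTorus (Fin 2) → EuclideanSpace ℝ (Fin 2))
      (w : ℝ → UnitAddTorus (Fin 2) → EuclideanSpace ℝ (Fin 2)) (q : ℝ → UnitAddTorus (Fin 2) → ℝ),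
      ShearCombDatum (P.N j₀) hz w₀ →
      Torus.IsSmoothSpaceTimeOn (Icc (CascadeParams.tInject j₀ hz) (tStart (J + 2))) w →
      Torus.IsSmoothSpaceTimeOn (Icc (CascadeParams.tInject j₀ hz) (tStart (J + 2))) q →
      (∀ t ∈ Icc (CascadeParams.tInject j₀ hz) (tStart (J + 2)), Torus.IsDivFree (w t)) →
      (∀ t ∈ Icc (CascadeParams.tInject j₀ hz) (tStart (J + 2)), ∀ x,
        Torus.timeDerivWithin (Icc (CascadeParams.tInject j₀ hz) (tStart (J + 2))) w t x +
          Torus.convect (P.field t) (w t) x + Torus.convect (w t) (P.field t) x =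
          ν • Torus.laplacian (w t) x - Torus.gradient (q t) x) →
      w (CascadeParams.tInject j₀ hz) = w₀ →
      ∀ B : ℝ, (∀ t ∈ Icc (CascadeParams.tInject j₀ hz) (tStart (J + 1)), Torus.vectorL2Sq (w t) ≤ B) →
      ∀ t ∈ Icc (tStart (J + 1)) (tStart (J + 2)),
        Torus.vectorL2Sq (w t) ≤ (5 * Real.exp (sawSigmaStar * P.γ)) ^ 2 * B) :
    K2PhaseGrowthClassical P 5 := by
  obtain ⟨ν₀, hν₀, H⟩ := hT
  refine ⟨ν₀, hν₀, fun ν hν j₀ J hj hz w₀ w q hd0 hw hq hdiv heq h0 t ht => ?_⟩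
  obtain ⟨n, rfl⟩ : ∃ n, J = j₀ + n := ⟨J - j₀, by omega⟩
  have h1 := envelope_of_phaseTransfer P hγ hγ8 hδ₀ hd hν.1 (G := fun _ => True) (fun _ _ => trivial)
    (fun j₀' J' hj' _ => H ν hν j₀' J' hj') n j₀ trivial hz w₀ w q hd0 hw hq hdiv heq h0 t
    ⟨(le_max_left _ _).trans ht.1, ht.2⟩
  have e : 2 * (j₀ + n + 1 - j₀) = 2 * (n + 1) := by omega
  rw [e, pow_mul]
  exact h1

/-- **`K2PhaseGrowthClassicalH P 5` from the one-phase transfer inequality WITHIN THE HORIZON** (pointwise in `P`,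
`0 ≤ γ ≤ 8`, `δ₀ > 0`, `d > 0`): for every lag `A` a threshold `ν₀(A)` such that the transfer inequality holds for the
target phases `J + 1 < J_{γ²−3}(ν) + A`; the guard `G J = (J < Jrate (γ²−3) ν + A)` is closed downwards. -/
theorem k2PhaseGrowthClassicalH_five_of_phaseTransferH (P : CascadeParams) (hγ : 0 ≤ P.γ) (hγ8 : P.γ ≤ 8)
    (hδ₀ : 0 < P.δ₀) (hd : 0 < P.d)
    (hT : ∀ A : ℕ, ∃ ν₀ : ℝ, 0 < ν₀ ∧ ∀ ν ∈ Ioc 0 ν₀, ∀ (j₀ J : ℕ), j₀ ≤ J → J + 1 < Jrate (P.γ ^ 2 - 3) ν + A →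
      ∀ (hz : Bool) (w₀ : UnitAddTorus (Fin 2) → EuclideanSpace ℝ (Fin 2))
      (w : ℝ → UnitAddTorus (Fin 2) → EuclideanSpace ℝ (Fin 2)) (q : ℝ → UnitAddTorus (Fin 2) → ℝ),
      ShearCombDatum (P.N j₀) hz w₀ →
      Torus.IsSmoothSpaceTimeOn (Icc (CascadeParams.tInject j₀ hz) (tStart (J + 2))) w →
      Torus.IsSmoothSpaceTimeOn (Icc (CascadeParams.tInject j₀ hz) (tStart (J + 2))) q →
      (∀ t ∈ Icc (CascadeParams.tInject j₀ hz) (tStart (J + 2)), Torus.IsDivFree (w t)) →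
      (∀ t ∈ Icc (CascadeParams.tInject j₀ hz) (tStart (J + 2)), ∀ x,
        Torus.timeDerivWithin (Icc (CascadeParams.tInject j₀ hz) (tStart (J + 2))) w t x +
          Torus.convect (P.field t) (w t) x + Torus.convect (w t) (P.field t) x =
          ν • Torus.laplacian (w t) x - Torus.gradient (q t) x) →
      w (CascadeParams.tInject j₀ hz) = w₀ →
      ∀ B : ℝ, (∀ t ∈ Icc (CascadeParams.tInject j₀ hz) (tStart (J + 1)), Torus.vectorL2Sq (w t) ≤ B) →
      ∀ t ∈ Icc (tStart (J + 1)) (tStart (J + 2)),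
        Torus.vectorL2Sq (w t) ≤ (5 * Real.exp (sawSigmaStar * P.γ)) ^ 2 * B) :
    K2PhaseGrowthClassicalH P 5 := by
  intro A
  obtain ⟨ν₀, hν₀, H⟩ := hT A
  refine ⟨ν₀, hν₀, fun ν hν j₀ J hj hJ hz w₀ w q hd0 hw hq hdiv heq h0 t ht => ?_⟩
  obtain ⟨n, rfl⟩ : ∃ n, J = j₀ + n := ⟨J - j₀, by omega⟩
  have h1 := envelope_of_phaseTransfer P hγ hγ8 hδ₀ hd hν.1 (G := fun J' => J' < Jrate (P.γ ^ 2 - 3) ν + A)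
    (fun J' h => by omega) (fun j₀' J' hj' hG' => H ν hν j₀' J' hj' hG') n j₀ hJ hz w₀ w q hd0 hw hq hdiv heq h0 t
    ⟨(le_max_left _ _).trans ht.1, ht.2⟩
  have e : 2 * (j₀ + n + 1 - j₀) = 2 * (n + 1) := by omega
  rw [e, pow_mul]
  exact h1

/-! ## §3 `Target` from the transfer inequality at the design point -/

/-- **The rung `Target` from ONE one-phase transfer inequality** at the K1loc′ point `⟨8, δ₀, 2, 1, 2⟩`,
`0 < δ₀ ≤ 2⁻¹⁰⁰`, cap `5` (plain form): per-phase `L²` amplification at most `5e^{8σ⋆} ≈ 59.6` of every classical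
linearised response generated by a residual-comb injection, given its energy history — then
`K2PhaseGrowthClassical ⟨8,δ₀,2,1,2⟩ 5` (`k2PhaseGrowthClassical_five_of_phaseTransfer`) and `target_of_K2cap_le_five`. -/
theorem target_of_phaseTransfer_eight {δ₀ : ℝ} (hδ₀ : 0 < δ₀) (hδ₀' : δ₀ ≤ (2 : ℝ)⁻¹ ^ 100)
    (hT : ∃ ν₀ : ℝ, 0 < ν₀ ∧ ∀ ν ∈ Ioc 0 ν₀, ∀ (j₀ J : ℕ), j₀ ≤ J → ∀ (hz : Bool)
      (w₀ : UnitAddTorus (Fin 2) → EuclideanSpace ℝ (Fin 2))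
      (w : ℝ → UnitAddTorus (Fin 2) → EuclideanSpace ℝ (Fin 2)) (q : ℝ → UnitAddTorus (Fin 2) → ℝ),
      ShearCombDatum (((⟨8, δ₀, 2, 1, 2⟩ : CascadeParams)).N j₀) hz w₀ →
      Torus.IsSmoothSpaceTimeOn (Icc (CascadeParams.tInject j₀ hz) (tStart (J + 2))) w →
      Torus.IsSmoothSpaceTimeOn (Icc (CascadeParams.tInject j₀ hz) (tStart (J + 2))) q →
      (∀ t ∈ Icc (CascadeParams.tInject j₀ hz) (tStart (J + 2)), Torus.IsDivFree (w t)) →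
      (∀ t ∈ Icc (CascadeParams.tInject j₀ hz) (tStart (J + 2)), ∀ x,
        Torus.timeDerivWithin (Icc (CascadeParams.tInject j₀ hz) (tStart (J + 2))) w t x +
          Torus.convect ((⟨8, δ₀, 2, 1, 2⟩ : CascadeParams).field t) (w t) x +
          Torus.convect (w t) ((⟨8, δ₀, 2, 1, 2⟩ : CascadeParams).field t) x =
          ν • Torus.laplacian (w t) x - Torus.gradient (q t) x) →
      w (CascadeParams.tInject j₀ hz) = w₀ →
      ∀ B : ℝ, (∀ t ∈ Icc (CascadeParams.tInject j₀ hz) (tStart (J + 1)), Torus.vectorL2Sq (w t) ≤ B) →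
      ∀ t ∈ Icc (tStart (J + 1)) (tStart (J + 2)),
        Torus.vectorL2Sq (w t) ≤ (5 * Real.exp (sawSigmaStar * 8)) ^ 2 * B) : Target :=
  target_of_K2cap_le_five hδ₀ hδ₀' (by norm_num) le_rfl
    (k2PhaseGrowthClassical_five_of_phaseTransfer ⟨8, δ₀, 2, 1, 2⟩ (by norm_num) le_rfl hδ₀ (by norm_num) hT)

/-- **The rung `Target` from the one-phase transfer inequality WITHIN THE HORIZON** at `⟨8, δ₀, 2, 1, 2⟩`,
`0 < δ₀ ≤ 2⁻¹⁰⁰`, cap `5`: for every lag `A` a threshold `ν₀(A)` such that the per-phase amplification `≤ 5e^{8σ⋆}`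
holds for the target phases `J + 1 < J_{61}(ν) + A` — the weakest K2 statement of record the route consumes
(`k2PhaseGrowthClassicalH_five_of_phaseTransferH` + `target_of_K2H_five`). -/
theorem target_of_phaseTransferH_eight {δ₀ : ℝ} (hδ₀ : 0 < δ₀) (hδ₀' : δ₀ ≤ (2 : ℝ)⁻¹ ^ 100)
    (hT : ∀ A : ℕ, ∃ ν₀ : ℝ, 0 < ν₀ ∧ ∀ ν ∈ Ioc 0 ν₀, ∀ (j₀ J : ℕ), j₀ ≤ J →
      J + 1 < Jrate ((8 : ℝ) ^ 2 - 3) ν + A → ∀ (hz : Bool)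
      (w₀ : UnitAddTorus (Fin 2) → EuclideanSpace ℝ (Fin 2))
      (w : ℝ → UnitAddTorus (Fin 2) → EuclideanSpace ℝ (Fin 2)) (q : ℝ → UnitAddTorus (Fin 2) → ℝ),
      ShearCombDatum (((⟨8, δ₀, 2, 1, 2⟩ : CascadeParams)).N j₀) hz w₀ →
      Torus.IsSmoothSpaceTimeOn (Icc (CascadeParams.tInject j₀ hz) (tStart (J + 2))) w →
      Torus.IsSmoothSpaceTimeOn (Icc (CascadeParams.tInject j₀ hz) (tStart (J + 2))) q →
      (∀ t ∈ Icc (CascadeParams.tInject j₀ hz) (tStart (J + 2)), Torus.IsDivFree (w t)) →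
      (∀ t ∈ Icc (CascadeParams.tInject j₀ hz) (tStart (J + 2)), ∀ x,
        Torus.timeDerivWithin (Icc (CascadeParams.tInject j₀ hz) (tStart (J + 2))) w t x +
          Torus.convect ((⟨8, δ₀, 2, 1, 2⟩ : CascadeParams).field t) (w t) x +
          Torus.convect (w t) ((⟨8, δ₀, 2, 1, 2⟩ : CascadeParams).field t) x =
          ν • Torus.laplacian (w t) x - Torus.gradient (q t) x) →
      w (CascadeParams.tInject j₀ hz) = w₀ →
      ∀ B : ℝ, (∀ t ∈ Icc (CascadeParams.tInject j₀ hz) (tStart (J + 1)), Torus.vectorL2Sq (w t) ≤ B) →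
      ∀ t ∈ Icc (tStart (J + 1)) (tStart (J + 2)),
        Torus.vectorL2Sq (w t) ≤ (5 * Real.exp (sawSigmaStar * 8)) ^ 2 * B) : Target :=
  target_of_K2H_five hδ₀ hδ₀'
    (k2PhaseGrowthClassicalH_five_of_phaseTransferH ⟨8, δ₀, 2, 1, 2⟩ (by norm_num) le_rfl hδ₀ (by norm_num) hT)

end Summit.AnomalousDissipation.AnomalousDissipation.Theorems.SawtoothPulseCascade.K2Classical

end
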